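import Summits.SmoothPoincare4.SmoothPoincare4.Theorems.DottedCircleRasmussenDcrGapHelperFriendsCarrierVkPartATubeLoops
import Summits.SmoothPoincare4.SmoothPoincare4.Theorems.DottedCircleRasmussenDcrGapHelperFriendsCarrierVkPartALoopDescent

/-!
# Helper `helper_friendsCarrier_Vk_partA_pushGlue` (piece 11 of the registered stub
`helper_friendsCarrier_Vk_partA`, line `mk_friends`, skeleton v8) for crux `DcrGap`
(item stmt-SmoothPoincare4-16128, route route-SmoothPoincare4-DottedCircleRasmussen)

**The push-off input of Part A from the two homological facts, local-to-global glue.**  Given a continuous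
tube `F : B(0,R) × B(0,η) → ℝ⁴` with continuous left inverse `Finv`, a subspace `Z` containing the punctured
tube, and a continuous loop `ℓ : 𝕊¹ → ℝ⁴` running in the punctured tube such that

* (global fact I) the loop `t ↦ ℓ(e^{2πit})` is null-homologous in `Z` (Hurewicz class `0` in `H₁(Z; ℤ)`), and
* (global fact III) the meridian `t ↦ F(x₀, e^{2πit} w₀)` through the base point `ℓ(1) = F(x₀, w₀)` has
  infinite order in `H₁(Z; ℤ)`,

the fibre-coordinate loop `u ↦ (Finv (ℓ u)).2` is freely null-homotopic in `ℝ² ∖ 0`: by `…VkPartATubeLoops`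
the class of the loop is `n` times that of the meridian, so `n = 0`, so the fibre loop read on `[0,1]` is
null-homotopic through loops, and by `…VkPartALoopDescent` this descends to the circle.

* `helper_friendsCarrier_Vk_partA_pushGlue` — the registered statement.

No definitions, no named facts, no `sorry`.

## References

* A. Hatcher, *Algebraic Topology*, CUP (2002), Thm. 1.7, Thm. 2A.1. [HatcherAT2002]
-/

-- the prescribed namespace `Summit.<P>.<Sub>.…` duplicates `SmoothPoincare4` (P = Sub)
set_option linter.dupNamespace false
set_option linter.style.longLine false

noncomputable section

open scoped Topology unitInterval
open Set Function Metric Filter Complex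
open Literature.Topology.FourManifolds Literature.Topology.FourManifolds.PlaneComplex
  Literature.AlgebraicTopology.SingularHomology

namespace Summit.SmoothPoincare4.SmoothPoincare4.Theorems.DcrGap.MkFriends

namespace FriendsCarrierVk

/-- `ofC (1 · toC w) = w` and `|ofC (e · toC w)| = |w|` helpers: the rotated fibre vector. [folklore] -/
theorem norm_ofC_mul_toC {e : ℂ} (he : ‖e‖ = 1) (w : EuclideanSpace ℝ (Fin 2)) : ‖ofC (e * toC w)‖ = ‖w‖ := by
  rw [Knot.TubularNbhd.norm_ofC, norm_mul, he, one_mul, norm_toC]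

/-- **Loops with the same values have the same Hurewicz class**, across subspaces: a loop of `A ⊆ B` has,
read in `B`, the class of any loop of `B` with the same values; in particular if it is null-homologous in
`A` it is in `B`. [folklore] -/
theorem loopClass_eq_zero_of_subset {A B : Set (EuclideanSpace ℝ (Fin 4))} (hAB : A ⊆ B) {a : ↥A} {b : ↥B}
    (γA : Path a a) (γB : Path b b) (h : ∀ t, ((γA t : ↥A) : EuclideanSpace ℝ (Fin 4)) = ((γB t : ↥B) : EuclideanSpace ℝ (Fin 4)))
    (h0 : loopClass ℤ ℤ (1 : ℤ) γA = 0) : loopClass ℤ ℤ (1 : ℤ) γB = 0 := by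
  let ι : C(↥A, ↥B) := ⟨fun y => ⟨y, hAB y.2⟩, continuous_subtype_val.subtype_mk _⟩
  have e : SingularSimplex.ofPath γB = SingularSimplex.ofPath (γA.map ι.continuous) := by
    apply SingularSimplex.toContinuousMap_injective
    ext s : 1
    rw [SingularSimplex.ofPath_apply, SingularSimplex.ofPath_apply]
    exact Subtype.ext (h _).symm
  rw [loopClass_eq_of_ofPath_eq ℤ ℤ 1 _ _ e, ← map_loopClass, h0, map_zero]

/-- **The push-off input from the two homological facts (glue).** [cite: HatcherAT2002, Thm. 2A.1] -/
theorem exists_nullhomotopy_of_classes (F : EuclideanSpace ℝ (Fin 2) × EuclideanSpace ℝ (Fin 2) → EuclideanSpace ℝ (Fin 4))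
    (Finv : EuclideanSpace ℝ (Fin 4) → EuclideanSpace ℝ (Fin 2) × EuclideanSpace ℝ (Fin 2)) (R η : ℝ) (hη : 0 < η)
    (hFc : ContinuousOn F (ball (0 : EuclideanSpace ℝ (Fin 2)) R ×ˢ ball (0 : EuclideanSpace ℝ (Fin 2)) η))
    (hFinvc : ContinuousOn Finv (F '' (ball (0 : EuclideanSpace ℝ (Fin 2)) R ×ˢ ball (0 : EuclideanSpace ℝ (Fin 2)) η)))
    (hleft : ∀ q ∈ ball (0 : EuclideanSpace ℝ (Fin 2)) R ×ˢ ball (0 : EuclideanSpace ℝ (Fin 2)) η, Finv (F q) = q)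
    (Z : Set (EuclideanSpace ℝ (Fin 4)))
    (hZ : F '' (ball (0 : EuclideanSpace ℝ (Fin 2)) R ×ˢ (ball (0 : EuclideanSpace ℝ (Fin 2)) η ∩ {w | w ≠ 0})) ⊆ Z)
    (ℓ : (sphere (0 : EuclideanSpace ℝ (Fin 2)) 1) → EuclideanSpace ℝ (Fin 4)) (hℓc : Continuous ℓ)
    (hℓ : ∀ u, ℓ u ∈ F '' (ball (0 : EuclideanSpace ℝ (Fin 2)) R ×ˢ (ball (0 : EuclideanSpace ℝ (Fin 2)) η ∩ {w | w ≠ 0})))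
    (hI : ∀ (p : ↥Z) (γ : Path p p), (∀ t : I, ((γ t : ↥Z) : EuclideanSpace ℝ (Fin 4)) = ℓ (circlePoint (2 * Real.pi * t))) →
      loopClass ℤ ℤ (1 : ℤ) γ = 0)
    (hIII : ∀ (p : ↥Z) (μ : Path p p), (p : EuclideanSpace ℝ (Fin 4)) = ℓ (circlePoint 0) →
      (∀ t : I, ((μ t : ↥Z) : EuclideanSpace ℝ (Fin 4)) =
        F ((Finv (p : EuclideanSpace ℝ (Fin 4))).1, ofC (Complex.exp (((2 * Real.pi * t : ℝ) : ℂ) * Complex.I) * toC (Finv (p : EuclideanSpace ℝ (Fin 4))).2))) →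
      ∀ n : ℤ, n • loopClass ℤ ℤ (1 : ℤ) μ = 0 → n = 0) :
    ∃ G : I × (sphere (0 : EuclideanSpace ℝ (Fin 2)) 1) → EuclideanSpace ℝ (Fin 2), Continuous G ∧ (∀ q, G q ≠ 0) ∧
      (∀ u, G (0, u) = (Finv (ℓ u)).2) ∧ ∃ e : EuclideanSpace ℝ (Fin 2), ∀ u, G (1, u) = e := by
  set dom : Set (EuclideanSpace ℝ (Fin 2) × EuclideanSpace ℝ (Fin 2)) :=
    ball (0 : EuclideanSpace ℝ (Fin 2)) R ×ˢ ball (0 : EuclideanSpace ℝ (Fin 2)) η with hdom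
  set pdom : Set (EuclideanSpace ℝ (Fin 2) × EuclideanSpace ℝ (Fin 2)) :=
    ball (0 : EuclideanSpace ℝ (Fin 2)) R ×ˢ (ball (0 : EuclideanSpace ℝ (Fin 2)) η ∩ {w | w ≠ 0}) with hpdom
  have hpd : pdom ⊆ dom := prod_mono Subset.rfl inter_subset_left
  have hright : ∀ y ∈ F '' dom, F (Finv y) = y := by
    rintro _ ⟨q, hq, rfl⟩; rw [hleft q hq]
  have hFinv_mem : ∀ y ∈ F '' pdom, Finv y ∈ pdom := by
    rintro _ ⟨q, hq, rfl⟩; rwa [hleft q (hpd hq)]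
  -- the loop on `[0, 1]`
  let p : ↥Z := ⟨ℓ (circlePoint 0), hZ (hℓ _)⟩
  have h2π1 : circlePoint (2 * Real.pi * (1 : ℝ)) = circlePoint 0 := by
    rw [mul_one, ← zero_add (2 * Real.pi), circlePoint_add_two_pi]
  let γ : Path p p :=
    { toFun := fun t => ⟨ℓ (circlePoint (2 * Real.pi * t)), hZ (hℓ _)⟩
      continuous_toFun := (hℓc.comp (continuous_circlePoint.comp (continuous_const.mul continuous_subtype_val))).subtype_mk _
      source' := by apply Subtype.ext; simp [p]
      target' := by apply Subtype.ext; change ℓ (circlePoint (2 * Real.pi * (1 : ℝ))) = ℓ (circlePoint 0); rw [h2π1] }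
  have hγval : ∀ t : I, ((γ t : ↥Z) : EuclideanSpace ℝ (Fin 4)) = ℓ (circlePoint (2 * Real.pi * t)) := fun t => rfl
  have hγmem : ∀ t : I, ((γ t : ↥Z) : EuclideanSpace ℝ (Fin 4)) ∈ F '' pdom := fun t => hℓ _
  obtain ⟨n, hclass, hnull⟩ := exists_meridian_exponent F Finv R η hη hFc hFinvc hleft Z hZ γ hγmem
  -- the meridian through `p`
  set x₀ : EuclideanSpace ℝ (Fin 2) := (Finv (p : EuclideanSpace ℝ (Fin 4))).1 with hx₀
  set w₀ : EuclideanSpace ℝ (Fin 2) := (Finv (p : EuclideanSpace ℝ (Fin 4))).2 with hw₀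
  have hq₀ : Finv (p : EuclideanSpace ℝ (Fin 4)) ∈ pdom := hFinv_mem _ (hℓ _)
  have hFp : F (x₀, w₀) = p := by rw [hx₀, hw₀, Prod.mk.eta]; exact hright _ (image_mono hpd (hℓ _))
  have hrot : ∀ t : I, (x₀, ofC (Complex.exp (((2 * Real.pi * t : ℝ) : ℂ) * Complex.I) * toC w₀)) ∈ pdom := fun t => by
    have he : ‖Complex.exp (((2 * Real.pi * t : ℝ) : ℂ) * Complex.I)‖ = 1 := by rw [Complex.norm_exp_ofReal_mul_I]
    refine ⟨hq₀.1, mem_ball_zero_iff.2 ?_, ?_⟩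
    · rw [norm_ofC_mul_toC he]; exact mem_ball_zero_iff.1 hq₀.2.1
    · show ofC _ ≠ 0
      intro h0
      have := congrArg norm h0
      rw [norm_ofC_mul_toC he, norm_zero, norm_eq_zero] at this
      exact hq₀.2.2 this
  have hrot0 : ofC (Complex.exp (((2 * Real.pi * (0 : ℝ) : ℝ) : ℂ) * Complex.I) * toC w₀) = w₀ := by
    simp [ofC_toC]
  have hrot1 : ofC (Complex.exp (((2 * Real.pi * (1 : ℝ) : ℝ) : ℂ) * Complex.I) * toC w₀) = w₀ := by
    rw [mul_one, show ((2 * Real.pi : ℝ) : ℂ) * Complex.I = 2 * Real.pi * Complex.I by push_cast; ring, Complex.exp_two_pi_mul_I,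
      one_mul, ofC_toC]
  let μ : Path p p :=
    { toFun := fun t => ⟨F (x₀, ofC (Complex.exp (((2 * Real.pi * t : ℝ) : ℂ) * Complex.I) * toC w₀)), hZ ⟨_, hrot t, rfl⟩⟩
      continuous_toFun := by
        refine Continuous.subtype_mk ?_ _
        have h1 : Continuous fun t : I => ((x₀, ofC (Complex.exp (((2 * Real.pi * t : ℝ) : ℂ) * Complex.I) * toC w₀)) :
            EuclideanSpace ℝ (Fin 2) × EuclideanSpace ℝ (Fin 2)) := by
          refine continuous_const.prodMk (continuous_ofC.comp ?_)
          fun_prop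
        exact hFc.comp_continuous h1 fun t => hpd (hrot t)
      source' := by apply Subtype.ext; change F (x₀, ofC _) = (p : EuclideanSpace ℝ (Fin 4)); rw [Set.Icc.coe_zero, hrot0, hFp]
      target' := by apply Subtype.ext; change F (x₀, ofC _) = (p : EuclideanSpace ℝ (Fin 4)); rw [Set.Icc.coe_one, hrot1, hFp] }
  have hμval : ∀ t : I, ((μ t : ↥Z) : EuclideanSpace ℝ (Fin 4)) =
      F ((Finv (p : EuclideanSpace ℝ (Fin 4))).1, ofC (Complex.exp (((2 * Real.pi * t : ℝ) : ℂ) * Complex.I) * toC (Finv (p : EuclideanSpace ℝ (Fin 4))).2)) :=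
    fun t => rfl
  -- the exponent vanishes
  have hn0 : n = 0 := by
    have h1 := hclass μ hμval
    rw [hI p γ hγval] at h1
    exact hIII p μ rfl hμval n h1.symm
  -- the null-homotopy of the fibre loop on `[0,1]` descends to the circle
  obtain ⟨h, hc, h0, hstart, hend, hloop⟩ := hnull hn0
  obtain ⟨G, hGc, hGh, hG0, hG1⟩ := helper_friendsCarrier_Vk_partA_loopDescent (EuclideanSpace ℝ (Fin 2))
    (fun u => (Finv (ℓ u)).2) h hc (fun t => by rw [hstart]; rfl) (fun s => by rw [(hloop s).1, (hloop s).2]) w₀ hend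
  exact ⟨G, hGc, fun q => by obtain ⟨q', hq'⟩ := hGh q; rw [hq']; exact h0 q', hG0, w₀, hG1⟩

end FriendsCarrierVk

open FriendsCarrierVk in
/-- **Helper `helper_friendsCarrier_Vk_partA_pushGlue`** (piece of `helper_friendsCarrier_Vk_partA`: local-to-global
glue for the push-off input).  For a continuous tube `F` on `B(0,R) × B(0,η)` with continuous left inverse
`Finv`, a subspace `Z` containing the punctured tube and a continuous loop `ℓ : 𝕊¹ → ℝ⁴` in the punctured tube:
if `t ↦ ℓ(e^{2πit})` is null-homologous in `Z` and the meridian through `ℓ(1)` has infinite order in `H₁(Z; ℤ)`,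
then `u ↦ (Finv (ℓ u)).2` is freely null-homotopic in `ℝ² ∖ 0`. [cite: HatcherAT2002, Thm. 2A.1] -/
theorem helper_friendsCarrier_Vk_partA_pushGlue : ∀ (F : EuclideanSpace ℝ (Fin 2) × EuclideanSpace ℝ (Fin 2) → EuclideanSpace ℝ (Fin 4)) (Finv : EuclideanSpace ℝ (Fin 4) → EuclideanSpace ℝ (Fin 2) × EuclideanSpace ℝ (Fin 2)) (R η : ℝ), 0 < η → ContinuousOn F (Metric.ball (0 : EuclideanSpace ℝ (Fin 2)) R ×ˢ Metric.ball (0 : EuclideanSpace ℝ (Fin 2)) η) → ContinuousOn Finv (F '' (Metric.ball (0 : EuclideanSpace ℝ (Fin 2)) R ×ˢ Metric.ball (0 : EuclideanSpace ℝ (Fin 2)) η)) → (∀ q ∈ Metric.ball (0 : EuclideanSpace ℝ (Fin 2)) R ×ˢ Metric.ball (0 : EuclideanSpace ℝ (Fin 2)) η, Finv (F q) = q) → ∀ (Z : Set (EuclideanSpace ℝ (Fin 4))), F '' (Metric.ball (0 : EuclideanSpace ℝ (Fin 2)) R ×ˢ (Metric.ball (0 : EuclideanSpace ℝ (Fin 2))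 η ∩ {w | w ≠ 0})) ⊆ Z → ∀ (ℓ : (Metric.sphere (0 : EuclideanSpace ℝ (Fin 2)) 1) → EuclideanSpace ℝ (Fin 4)), Continuous ℓ → (∀ u, ℓ u ∈ F '' (Metric.ball (0 : EuclideanSpace ℝ (Fin 2)) R ×ˢ (Metric.ball (0 : EuclideanSpace ℝ (Fin 2)) η ∩ {w | w ≠ 0}))) → (∀ (p : ↥Z) (γ : Path p p), (∀ t : unitInterval, ((γ t : ↥Z) : EuclideanSpace ℝ (Fin 4)) = ℓ (Literature.Topology.FourManifolds.circlePoint (2 * Real.pi * t))) → Literature.AlgebraicTopology.SingularHomology.loopClass ℤ ℤ (1 : ℤ) γ = 0) → (∀ (p : ↥Z) (μ : Path p p), (p : EuclideanSpace ℝ (Fin 4)) = ℓ (Literature.Topology.FourManifolds.circlePoint 0) → (∀ t : unitInterval, ((μ t : ↥Z) : EuclideanSpace ℝ (Fin 4)) = F ((Finv (p : EuclideanSpace ℝ (Fin 4))).1, Literature.Topology.FourManifolds.PlaneComplex.ofC (Complex.exp (((2 * Real.pi * t : ℝ) : ℂ) * Complex.I) * Literature.Topology.FourManifolds.toC (Finv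 (p : EuclideanSpace ℝ (Fin 4))).2))) → ∀ n : ℤ, n • Literature.AlgebraicTopology.SingularHomology.loopClass ℤ ℤ (1 : ℤ) μ = 0 → n = 0) → ∃ G : unitInterval × (Metric.sphere (0 : EuclideanSpace ℝ (Fin 2)) 1) → EuclideanSpace ℝ (Fin 2), Continuous G ∧ (∀ q, G q ≠ 0) ∧ (∀ u, G (0, u) = (Finv (ℓ u)).2) ∧ ∃ e : EuclideanSpace ℝ (Fin 2), ∀ u, G (1, u) = e := by
  intro F Finv R η hη hFc hFinvc hleft Z hZ ℓ hℓc hℓ hI hIII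
  exact exists_nullhomotopy_of_classes F Finv R η hη hFc hFinvc hleft Z hZ ℓ hℓc hℓ hI hIII

end Summit.SmoothPoincare4.SmoothPoincare4.Theorems.DcrGap.MkFriends

end
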